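import Summits.ResolutionOfSingularities.ResolutionOfSingularities.Theorems.UniversalCellsCampaignW82FrobeniusTwistRungs
import Literature.AlgebraicGeometry.Resolution.BirationalDimensionInequality
import Literature.AlgebraicGeometry.Resolution.ComponentsUnderIntegralFlat
import Mathlib.AlgebraicGeometry.Morphisms.SchemeTheoreticallyDominant
import HarnessLib


/-!
# [OURS · L1 W8.2] The residual of slot W8.2 concerns REGULAR varieties only (rung B, prime-field / family
# transfer) — proofs

Cell `res-hironaka` (run/shared/lean/pub/res-hironaka/), LADDER-RESOLUTION rung L (RESCUE), slot W8.2, host route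
`UniversalCells`, host item `PrimeFieldToPerfect` (stmt-ResolutionOfSingularities-15233), second door
`UniformComplexity` `PrimeModelTransfer` (stmt-ResolutionOfSingularities-8933). Prover res-L1-s82-pv-1 (gen 2).
THESES-FREE (imports only Theses-free campaign modules, Literature and Mathlib).

WHAT IS PROVED (name `FrobeniusTwistStepRegularAt` from the v2 append of the statement file
Theorems/UniversalCellsCampaignW82FrobeniusTwistGraded.lean; everything unconditional):

* `isIntegral_pullback_of_isBirational` — INTEGRALITY AFTER A GROUND FIELD EXTENSION IS A BIRATIONAL INVARIANT
  (Stacks 054Q / 04KS, in the shape needed): for `σ : K → L`, `f₀ : X₀ ⟶ Spec K`, `g₀ : Y₀ ⟶ Spec K` of finite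
  type, `Y₀` integral and `π : Y₀ ⟶ X₀` a birational `K`-morphism, `X₀ ×_{K,σ} L` integral ⇒ `Y₀ ×_{K,σ} L`
  integral. Irreducibility: the dense open `q⁻¹π⁻¹U ⊆ Y_L` is isomorphic to the open `p⁻¹U` of the integral
  `X_L` (flat base change of the isomorphism `π ∣ U`; density by `Resolution.dense_preimage_of_flat`).
  Reducedness WITHOUT Serre's criterion: the dense open immersion `π⁻¹U ↪ Y₀` into the reduced `Y₀` is
  scheme-theoretically dominant, scheme-theoretic dominance survives the FLAT base change `Y_L ⟶ Y₀` (Mathlib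
  `IsSchemeTheoreticallyDominant.pullbackFst`), and its source there is reduced, so `Y_L` is reduced
  (`IsSchemeTheoreticallyDominant.isReduced`).
* `integralOverPerfectClosure_of_isBirational` — hence `IntegralOverPerfectClosure` passes from `X₀` to every
  integral `Y₀` birational over it (e.g. a resolution).
* `hasSmoothFrobeniusTwistModel_of_isBirational` — conversely a smooth Frobenius-twist model of a proper
  birational `K`-model `Z ⟶ X₀` is one of `X₀` (twist the model map by flat base change, compose).
* `frobeniusTwistStepAt_iff_regular` — for every field `M` of characteristic `p` and grade `n`:
  `FrobeniusTwistStepAt p M n ↔ FrobeniusTwistStepRegularAt p M n` (resolve `X₀` by the hypothesis over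
  `RatFunc M`; dimension by `IsBirational.topologicalKrullDim_eq_of_isProper`).

CONSEQUENCE FOR THE SLOT (numbers, not adjectives): combined with p481612 / p483734 the residual of W8.2 — open
exactly for grades `n ≥ 4` — reads, kernel-checked: «given resolution of integral separated schemes of finite
type of dimension `≤ n` over `M(t)` (`M` perfect), every REGULAR irreducible geometrically reduced `X₀` of
dimension `≤ n` over `M(t)` has some Frobenius twist `X₀ ×_{M(t),Frob^e} M(t)` with a proper birational model
SMOOTH over `M(t)`» — i.e. the rescue must SMOOTH regular-but-non-smooth varieties (Kollár's curve
`y² = x^p − t`, quasi-elliptic surfaces, …) by twisting and modifying; nothing else is left of the printed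
«transcendence degree d … dimension d + dim Z» device at rung B.

HONEST FRAMING. OURS work of the rescue rung; replaces the role of §17 ¶2 p.89 l.59–62 / §2 p.4 l.22–24 of
[Hironaka2017] as explained in the statement file; NOT a statement of the manuscript; nothing attributed to its
author; no typed candidate used even as a hypothesis; no external premise. AI work, weaker than expert review.

BARRIERS (`Literature/Barriers/ResolutionOfSingularities/`): the reduction to regular `X₀` is the precise sense in
which `RegularNotGeometricallyRegular.lean` IS the residual: a regular model is free (hypothesis), a smooth one of
some twist is what is asked.

## References
* The Stacks Project, Tags 054Q, 04KS (geometric reducedness/integrality is decided at the generic point),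
  01RN (birational). [StacksProject]
* U. Görtz, T. Wedhorn, *Algebraic Geometry I*, 2nd ed. (2020), Prop. 5.38. [GortzWedhorn2020]
* Cruxes/PrimeFieldToPerfect/KERNEL.md §3–§4; STRATEGY-CENSUS.md (N2); L/res-L1-s82-pv-1/NOTES.md — cell files.
-/

noncomputable section

set_option linter.dupNamespace false -- mandated namespace of this single-conjunct summit

open _root_.CategoryTheory _root_.CategoryTheory.Limits _root_.AlgebraicGeometry
open Literature.AlgebraicGeometry.Resolution

namespace Summit.ResolutionOfSingularities.ResolutionOfSingularities.Theorems.CampaignW82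

/-! ## Integrality of a ground field extension is a birational invariant -/

/-- **Integrality after a ground field extension is a birational invariant** (Stacks 054Q / 04KS in the
shape needed here). Let `σ : K → L` be a map of fields, `f₀ : X₀ ⟶ Spec K` and `g₀ : Y₀ ⟶ Spec K` of finite
type, `Y₀` integral, and `π : Y₀ ⟶ X₀` a birational `K`-morphism. If `X₀ ×_{K,σ} Spec L` is integral, then so
is `Y₀ ×_{K,σ} Spec L`. Proof: `π_L : Y_L ⟶ X_L` is the flat base change of `π` along `p : X_L ⟶ X₀`, hence an
isomorphism over `p⁻¹U` for the dense open `U ⊆ X₀` over which `π` is one; so the open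
`W = π_L⁻¹ p⁻¹ U = q⁻¹ π⁻¹ U ⊆ Y_L` (`q : Y_L ⟶ Y₀`) is isomorphic to the open `p⁻¹U` of the integral `X_L`,
and it is dense (`q` is flat, `π⁻¹U` dense in the Noetherian `Y₀`), so `Y_L` is irreducible; and `Y_L` is
REDUCED because the dense open immersion `π⁻¹U ↪ Y₀` into the reduced `Y₀` is scheme-theoretically dominant,
scheme-theoretic dominance is preserved by the FLAT base change `q` (Mathlib
`IsSchemeTheoreticallyDominant.pullbackFst`), and a scheme receiving a scheme-theoretically dominant
morphism from a reduced scheme is reduced (`IsSchemeTheoreticallyDominant.isReduced`).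
[cite: StacksProject, Tag 054Q] -/
theorem isIntegral_pullback_of_isBirational {K L : Type} [Field K] [Field L] (σ : K →+* L)
    {X₀ Y₀ : Scheme.{0}} (f₀ : X₀ ⟶ Spec (.of K)) [LocallyOfFiniteType f₀] [QuasiCompact f₀]
    (g₀ : Y₀ ⟶ Spec (.of K)) [LocallyOfFiniteType g₀] [QuasiCompact g₀] [IsIntegral Y₀]
    (π : Y₀ ⟶ X₀) (w : π ≫ f₀ = g₀) (hπ : IsBirational π)
    [IsIntegral (pullback f₀ (Spec.map (CommRingCat.ofHom σ)))] :
    IsIntegral (pullback g₀ (Spec.map (CommRingCat.ofHom σ))) := by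
  haveI : IsNoetherian X₀ := Scheme.isNoetherian_of_finiteType_over_field f₀
  haveI : IsNoetherian Y₀ := Scheme.isNoetherian_of_finiteType_over_field g₀
  haveI : Flat (Spec.map (CommRingCat.ofHom σ)) := DeJong1996.Stage.flat_specMap σ
  haveI : Surjective (Spec.map (CommRingCat.ofHom σ)) := DeJong1996.Stage.surjective_specMap σ
  -- notation: `p : X_L → X₀`, `q : Y_L → Y₀`, `π_L : Y_L → X_L`
  let p := pullback.fst f₀ (Spec.map (CommRingCat.ofHom σ))
  let q := pullback.fst g₀ (Spec.map (CommRingCat.ofHom σ))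
  have hw : (q ≫ π) ≫ f₀ =
      pullback.snd g₀ (Spec.map (CommRingCat.ofHom σ)) ≫ Spec.map (CommRingCat.ofHom σ) := by
    rw [Category.assoc, w]; exact pullback.condition
  let πL : pullback g₀ (Spec.map (CommRingCat.ofHom σ)) ⟶
      pullback f₀ (Spec.map (CommRingCat.ofHom σ)) :=
    pullback.lift (q ≫ π) (pullback.snd _ _) hw
  have hπL₁ : πL ≫ p = q ≫ π := pullback.lift_fst _ _ _
  have hπL₂ : πL ≫ pullback.snd f₀ (Spec.map (CommRingCat.ofHom σ)) =
      pullback.snd g₀ (Spec.map (CommRingCat.ofHom σ)) := pullback.lift_snd _ _ _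
  -- the square `(π_L, q, p, π)` is cartesian
  have sq : IsPullback πL q p π := by
    refine IsPullback.of_right (h₁₂ := pullback.snd f₀ (Spec.map (CommRingCat.ofHom σ)))
      (v₁₃ := Spec.map (CommRingCat.ofHom σ)) (h₂₂ := f₀) ?_ hπL₁
      (IsPullback.of_hasPullback f₀ (Spec.map (CommRingCat.ofHom σ))).flip
    rw [hπL₂, w]
    exact (IsPullback.of_hasPullback g₀ (Spec.map (CommRingCat.ofHom σ))).flip
  haveI : Flat q := MorphismProperty.pullback_fst _ _ inferInstance
  haveI : Surjective q := MorphismProperty.pullback_fst _ _ inferInstance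
  -- the dense open `U ⊆ X₀` over which `π` is an isomorphism, `V = π⁻¹ U`, `W = q⁻¹ V = π_L⁻¹ p⁻¹ U`
  obtain ⟨U, hU, hV, hiso⟩ := hπ
  have hWeq : q ⁻¹ᵁ (π ⁻¹ᵁ U) = πL ⁻¹ᵁ (p ⁻¹ᵁ U) := by
    rw [← Scheme.Hom.comp_preimage, ← Scheme.Hom.comp_preimage, hπL₁]
  -- `π_L` restricted over `p⁻¹ U` is an isomorphism (base change of `π ∣ U`)
  obtain ⟨g', sqU⟩ :=
    Summit.ResolutionOfSingularities.ResolutionOfSingularities.Theorems.exists_isPullback_morphismRestrict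
      sq U
  haveI : IsIso (πL ∣_ (p ⁻¹ᵁ U)) := sqU.isIso_fst_of_isIso
  -- `W` is dense in `Y_L` and nonempty; `p⁻¹ U` is a nonempty open of the integral `X_L`
  have hWdense : Dense ((q ⁻¹ᵁ (π ⁻¹ᵁ U) : (pullback g₀ (Spec.map (CommRingCat.ofHom σ))).Opens) :
      Set ↥(pullback g₀ (Spec.map (CommRingCat.ofHom σ)))) :=
    dense_preimage_of_flat q (π ⁻¹ᵁ U).isOpen hV
  haveI : Nonempty ↥(pullback g₀ (Spec.map (CommRingCat.ofHom σ))) :=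
    ⟨(q.surjective (Nonempty.some inferInstance)).choose⟩
  have hWne' : ((q ⁻¹ᵁ (π ⁻¹ᵁ U) : (pullback g₀ (Spec.map (CommRingCat.ofHom σ))).Opens) :
      Set ↥(pullback g₀ (Spec.map (CommRingCat.ofHom σ)))).Nonempty := hWdense.nonempty
  haveI hWne : Nonempty (πL ⁻¹ᵁ (p ⁻¹ᵁ U)).toScheme := by
    rw [← hWeq]
    exact (Scheme.Opens.nonempty_iff _).2 hWne'
  haveI : Nonempty (p ⁻¹ᵁ U).toScheme := ⟨(πL ∣_ (p ⁻¹ᵁ U)) (Nonempty.some hWne)⟩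
  haveI : IsIntegral (p ⁻¹ᵁ U).toScheme := isIntegral_of_isOpenImmersion (p ⁻¹ᵁ U).ι
  haveI hWint : IsIntegral (πL ⁻¹ᵁ (p ⁻¹ᵁ U)).toScheme :=
    isIntegral_of_isOpenImmersion (πL ∣_ (p ⁻¹ᵁ U))
  -- ### `Y_L` is irreducible: it contains the dense irreducible open `W`
  haveI : IrreducibleSpace ↥(pullback g₀ (Spec.map (CommRingCat.ofHom σ))) := by
    have hWirr : IsIrreducible ((πL ⁻¹ᵁ (p ⁻¹ᵁ U) :
        (pullback g₀ (Spec.map (CommRingCat.ofHom σ))).Opens) :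
          Set ↥(pullback g₀ (Spec.map (CommRingCat.ofHom σ)))) := by
      have h := (IrreducibleSpace.isIrreducible_univ ↥((πL ⁻¹ᵁ (p ⁻¹ᵁ U)).toScheme)).image _
        (πL ⁻¹ᵁ (p ⁻¹ᵁ U)).ι.continuous.continuousOn
      rwa [Set.image_univ, Scheme.Opens.range_ι] at h
    rw [irreducibleSpace_def]
    have hcl := isIrreducible_iff_closure.2 hWirr
    rwa [← hWeq, hWdense.closure_eq] at hcl
  -- ### `Y_L` is reduced: flat base change of the scheme-theoretically dominant `π⁻¹U ↪ Y₀`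
  haveI : IsDominant (π ⁻¹ᵁ U).ι := ⟨by
    show Dense (Set.range _)
    rw [Scheme.Opens.range_ι]
    exact hV⟩
  haveI : IsSchemeTheoreticallyDominant (π ⁻¹ᵁ U).ι := .of_isDominant _
  haveI : IsReduced (pullback q (π ⁻¹ᵁ U).ι) := by
    haveI : IsReduced (q ⁻¹ᵁ (π ⁻¹ᵁ U)).toScheme := by
      rw [hWeq]; infer_instance
    exact isReduced_of_isOpenImmersion (pullbackRestrictIsoRestrict q (π ⁻¹ᵁ U)).hom
  haveI : IsReduced (pullback g₀ (Spec.map (CommRingCat.ofHom σ))) :=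
    IsSchemeTheoreticallyDominant.isReduced (pullback.fst q (π ⁻¹ᵁ U).ι)
  exact isIntegral_of_irreducibleSpace_of_isReduced _

/-- **`IntegralOverPerfectClosure` is a birational invariant**: if `π : Y₀ ⟶ X₀` is a birational
`K`-morphism from an integral `Y₀` (e.g. a resolution of `X₀`) and `X₀` is integral over the perfect closure,
then so is `Y₀` (the same perfect purely inseparable witness `L`; `isIntegral_pullback_of_isBirational`).
[folklore] -/
theorem integralOverPerfectClosure_of_isBirational {K : Type} [Field K] {X₀ Y₀ : Scheme.{0}}
    (f₀ : X₀ ⟶ Spec (.of K)) [LocallyOfFiniteType f₀] [QuasiCompact f₀]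
    (g₀ : Y₀ ⟶ Spec (.of K)) [LocallyOfFiniteType g₀] [QuasiCompact g₀] [IsIntegral Y₀]
    (π : Y₀ ⟶ X₀) (w : π ≫ f₀ = g₀) (hπ : IsBirational π) (h : IntegralOverPerfectClosure K f₀) :
    IntegralOverPerfectClosure K g₀ := by
  obtain ⟨L, _, _, _, _, hXL⟩ := h
  haveI := hXL
  exact ⟨L, inferInstance, inferInstance, inferInstance, inferInstance,
    isIntegral_pullback_of_isBirational (algebraMap K L) f₀ g₀ π w hπ⟩

/-! ## A smooth Frobenius-twist model of a proper birational model is one of the variety -/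

/-- **Smooth Frobenius-twist models pass down proper birational `K`-morphisms**: if `ρ : Z ⟶ X₀` is proper
birational over `K` (e.g. a resolution of `X₀`) and some Frobenius twist of `Z` has a proper birational model
smooth over `K`, then so has the same twist of `X₀` — twist `ρ` (base change along the flat
`X₀^{(p^e)} ⟶ X₀`, `Theorems.isBirational_of_isPullback_of_flat`) and compose (`IsBirational.comp`).
[folklore] -/
theorem hasSmoothFrobeniusTwistModel_of_isBirational (p : ℕ) [Fact p.Prime] (K : Type) [Field K]
    [CharP K p] {X₀ Z : Scheme.{0}} (f₀ : X₀ ⟶ Spec (.of K)) [LocallyOfFiniteType f₀] [QuasiCompact f₀]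
    (ρ : Z ⟶ X₀) [IsProper ρ] (hρ : IsBirational ρ) (hZ : HasSmoothFrobeniusTwistModel p K (ρ ≫ f₀)) :
    HasSmoothFrobeniusTwistModel p K f₀ := by
  obtain ⟨e, Y, π, hprop, hbir, hsm⟩ := hZ
  haveI := hprop
  haveI := hsm
  haveI : IsNoetherian X₀ := Scheme.isNoetherian_of_finiteType_over_field f₀
  haveI : IsNoetherian Z := Scheme.isNoetherian_of_finiteType_over_field (ρ ≫ f₀)
  set s := Spec.map (CommRingCat.ofHom (iterateFrobenius K p e)) with hs
  haveI : Flat s := DeJong1996.Stage.flat_specMap _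
  -- the twist `ρ^{(e)} : Z^{(p^e)} → X₀^{(p^e)}` of `ρ`
  have hw : (pullback.fst (ρ ≫ f₀) s ≫ ρ) ≫ f₀ = pullback.snd (ρ ≫ f₀) s ≫ s := by
    rw [Category.assoc]; exact pullback.condition
  let ρ' : pullback (ρ ≫ f₀) s ⟶ pullback f₀ s := pullback.lift (pullback.fst _ _ ≫ ρ) (pullback.snd _ _) hw
  have h₁ : ρ' ≫ pullback.fst f₀ s = pullback.fst (ρ ≫ f₀) s ≫ ρ := pullback.lift_fst _ _ _
  have h₂ : ρ' ≫ pullback.snd f₀ s = pullback.snd (ρ ≫ f₀) s := pullback.lift_snd _ _ _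
  have sq : IsPullback ρ' (pullback.fst (ρ ≫ f₀) s) (pullback.fst f₀ s) ρ := by
    refine IsPullback.of_right (h₁₂ := pullback.snd f₀ s) (v₁₃ := s) (h₂₂ := f₀) ?_ h₁
      (IsPullback.of_hasPullback f₀ s).flip
    rw [h₂]
    exact (IsPullback.of_hasPullback (ρ ≫ f₀) s).flip
  haveI : IsProper ρ' := MorphismProperty.of_isPullback sq.flip ‹IsProper ρ›
  have hbir' : IsBirational ρ' :=
    Summit.ResolutionOfSingularities.ResolutionOfSingularities.Theorems.isBirational_of_isPullback_of_flat
      sq.flip hρ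
  refine ⟨e, Y, π ≫ ρ', inferInstance, hbir.comp hbir', ?_⟩
  rw [Category.assoc, h₂]
  exact hsm

/-! ## The Frobenius-twist step may be checked on REGULAR varieties only -/

/-- **The residual of slot W8.2 concerns regular varieties only**: for every field `M` of characteristic
`p` and every grade `n`, `FrobeniusTwistStepAt p M n ↔ FrobeniusTwistStepRegularAt p M n`. The non-trivial
direction: given `X₀` (separated of finite type over `RatFunc M`, dimension `≤ n`, integral over the perfect
closure — hence integral, by flat descent), RESOLVE it by the hypothesis over `RatFunc M`: `ρ : Y₀ ⟶ X₀`
proper birational with `Y₀` regular, hence integral (`IsBirational.irreducibleSpace`, regular ⇒ reduced), of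
the same dimension (`IsBirational.topologicalKrullDim_eq_of_isProper`), and integral over the perfect closure
(`integralOverPerfectClosure_of_isBirational`); the regular case gives a smooth Frobenius-twist model of `Y₀`,
which passes down to `X₀` (`hasSmoothFrobeniusTwistModel_of_isBirational`). So what the slot's residual asks
of a rescue is exactly: SMOOTH some Frobenius twist of every REGULAR irreducible geometrically reduced
variety over `M(t)` (dimension `≤ n`) by a proper birational modification — the situation of the barrier
examples (Kollár's regular non-smooth curve `y² = x^p − t`, quasi-elliptic surfaces). [folklore] -/
theorem frobeniusTwistStepAt_iff_regular (p : ℕ) [Fact p.Prime] (M : Type) [Field M] [CharP M p]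
    (n : WithBot ℕ∞) : FrobeniusTwistStepAt p M n ↔ FrobeniusTwistStepRegularAt p M n := by
  refine ⟨fun h hM X₀ f₀ hs hl hq hd hint _ => h hM X₀ f₀ hs hl hq hd hint, fun h hM X₀ f₀ hs hl hq hd hint => ?_⟩
  haveI := hs
  haveI := hl
  haveI := hq
  -- `X₀` is integral (flat descent from the integral `X₀ ×_K L`)
  haveI : IsIntegral X₀ := by
    obtain ⟨L, _, _, _, _, hXL⟩ := hint
    haveI := hXL
    haveI : Flat (pullback.fst f₀ (Spec.map (CommRingCat.ofHom (algebraMap (RatFunc M) L)))) :=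
      MorphismProperty.pullback_fst _ _ (DeJong1996.Stage.flat_specMap _)
    haveI : Surjective (pullback.fst f₀ (Spec.map (CommRingCat.ofHom (algebraMap (RatFunc M) L)))) :=
      MorphismProperty.pullback_fst _ _ (DeJong1996.Stage.surjective_specMap _)
    exact DeJong1996.Stage.isIntegral_of_flat_surjective
      (pullback.fst f₀ (Spec.map (CommRingCat.ofHom (algebraMap (RatFunc M) L))))
  haveI : IsNoetherian X₀ := Scheme.isNoetherian_of_finiteType_over_field f₀
  -- resolve `X₀` over `RatFunc M`
  obtain ⟨Y₀, ρ, hρ⟩ := hM X₀ f₀ hs hl hq inferInstance hd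
  haveI := hρ.isProper
  haveI : IrreducibleSpace Y₀ := hρ.isBirational.irreducibleSpace
  haveI : IsReduced Y₀ := hρ.isRegular.isReduced
  haveI : IsIntegral Y₀ := isIntegral_of_irreducibleSpace_of_isReduced Y₀
  have hdY : topologicalKrullDim Y₀ ≤ n := by
    rw [hρ.isBirational.topologicalKrullDim_eq_of_isProper]; exact hd
  have hintY : IntegralOverPerfectClosure (RatFunc M) (ρ ≫ f₀) :=
    integralOverPerfectClosure_of_isBirational f₀ (ρ ≫ f₀) ρ rfl hρ.isBirational hint
  have hY : HasSmoothFrobeniusTwistModel p (RatFunc M) (ρ ≫ f₀) :=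
    h hM Y₀ (ρ ≫ f₀) inferInstance inferInstance inferInstance hdY hintY hρ.isRegular
  exact hasSmoothFrobeniusTwistModel_of_isBirational p (RatFunc M) f₀ ρ hρ.isBirational hY

/-! ## v2 (append-only): the four normal forms of the residual are equivalent (TFAE)

Everything above this line is byte-identical with v1 (p485872). Appended by res-L1-s82-pv-1 (gen 2). -/

/-- **THE RESIDUAL OF SLOT W8.2 — FOUR EQUIVALENT NORMAL FORMS** (every field `M` of characteristic `p`, every
grade `n`; all unconditional, Theses-free): (1) `PerfectionStepAt M n` — resolution over `M(t)` in dimension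
`≤ n` ⇒ resolution over the perfect `M(t)^{perf}` (o6's lane-signed residuals p469608 / p470934 / p475047 are
`∀ M, (1)` over their classes of `M`); (2) `SmoothTwistStepAt M n` — … ⇒ every irreducible geometrically
reduced `X₀` over a finite purely inseparable level acquires a SMOOTH proper birational model at a further
finite level (p481193 / p481612); (3) `FrobeniusTwistStepAt p M n` — … ⇒ every such `X₀` over `M(t)` itself
has some FROBENIUS TWIST with a smooth proper birational model over `M(t)` (p483512 / p483734); (4)
`FrobeniusTwistStepRegularAt p M n` — the same for REGULAR `X₀` only (p485672 / p485872). [folklore] -/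
theorem residual_normalForms_tfae (p : ℕ) [Fact p.Prime] (M : Type) [Field M] [CharP M p]
    (n : WithBot ℕ∞) :
    List.TFAE [PerfectionStepAt M n, SmoothTwistStepAt M n, FrobeniusTwistStepAt p M n,
      FrobeniusTwistStepRegularAt p M n] := by
  tfae_have 1 ↔ 2 := perfectionStepAt_iff_smoothTwistStepAt M n
  tfae_have 1 ↔ 3 := perfectionStepAt_iff_frobeniusTwistStepAt p M n
  tfae_have 3 ↔ 4 := frobeniusTwistStepAt_iff_regular p M n
  tfae_finish

/-- **Door 1 in regular form**: `PerfectionStepDimLe p n ↔ ∀ M perfect of characteristic p,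
FrobeniusTwistStepRegularAt p M n`. [folklore] -/
theorem perfectionStepDimLe_iff_forall_frobeniusTwistStepRegularAt (p : ℕ) [Fact p.Prime]
    (n : WithBot ℕ∞) :
    PerfectionStepDimLe p n ↔
      ∀ (M : Type) [Field M] [CharP M p] [PerfectField M], FrobeniusTwistStepRegularAt p M n :=
  ⟨fun h M _ _ _ => (frobeniusTwistStepAt_iff_regular p M n).1
      ((perfectionStepAt_iff_frobeniusTwistStepAt p M n).1 (h M)),
    fun h M _ _ _ => (perfectionStepAt_iff_frobeniusTwistStepAt p M n).2
      ((frobeniusTwistStepAt_iff_regular p M n).2 (h M))⟩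

/-- **Door 2 (sharpest residual, p475047) in regular form**: `PerfectionStepAlgClosureFgDimLe p n ↔ ∀ K s,
FrobeniusTwistStepRegularAt p ((closure s)^{alg} ∩ K) n`. [folklore] -/
theorem perfectionStepAlgClosureFgDimLe_iff_forall_frobeniusTwistStepRegularAt (p : ℕ) [Fact p.Prime]
    (n : WithBot ℕ∞) :
    PerfectionStepAlgClosureFgDimLe p n ↔
      ∀ (K : Type) [Field K] [CharP K p] [IsAlgClosed K] (s : Finset K),
        FrobeniusTwistStepRegularAt p (algebraicClosure (Subfield.closure (↑s : Set K)) K) n :=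
  ⟨fun h K _ _ _ s => (frobeniusTwistStepAt_iff_regular p _ n).1
      ((perfectionStepAt_iff_frobeniusTwistStepAt p _ n).1 (h K s)),
    fun h K _ _ _ s => (perfectionStepAt_iff_frobeniusTwistStepAt p _ n).2
      ((frobeniusTwistStepAt_iff_regular p _ n).2 (h K s))⟩

/-! ## v3 (append-only): rungs of the regular form and the headline grade `(5, 4)`

Everything above this line is byte-identical with v2 (p486090). Appended by res-L1-s82-pv-1 (gen 2). -/

/-- The regular form, rung `n ≤ 1`, UNCONDITIONAL (every field `M` of characteristic `p`). [folklore] -/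
theorem frobeniusTwistStepRegularAt_of_le_one (p : ℕ) [Fact p.Prime] (M : Type) [Field M] [CharP M p]
    {n : WithBot ℕ∞} (hn : n ≤ 1) : FrobeniusTwistStepRegularAt p M n :=
  frobeniusTwistStepRegularAt_of_frobeniusTwistStepAt (frobeniusTwistStepAt_of_le_one p M hn)

/-- The regular form, rung `n ≤ 3`, CONDITIONAL on the named fact F-02 `CossartPiltant2019` (`hCP`); so
`n = 4` is the first open rung of the regular form as well. [cite: CossartPiltant2019, Thm. 1.1] -/
theorem frobeniusTwistStepRegularAt_of_le_three (hCP : CossartPiltant2019.{0}) (p : ℕ) [Fact p.Prime]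
    (M : Type) [Field M] [CharP M p] {n : WithBot ℕ∞} (hn : n ≤ 3) : FrobeniusTwistStepRegularAt p M n :=
  frobeniusTwistStepRegularAt_of_frobeniusTwistStepAt (frobeniusTwistStepAt_of_le_three hCP p M hn)

/-- **THE HEADLINE GRADE OF SLOT W8.2 IN FINAL FORM**: the first open rung `(5, 4)` of the graded kernel
`ClimbRatFuncPerfDimLe p 5 4` («resolution of integral separated schemes of finite type of dimension `≤ 5` over a
perfect `M` of characteristic `p` ⇒ resolution in dimension `≤ 4` over `M(t)^{perf}`») follows from the regular
Frobenius-twist form at grade `4` alone: «for every perfect `M` of characteristic `p` with resolution in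
dimension `≤ 4` over `M(t)`, every REGULAR irreducible geometrically reduced fourfold over `M(t)` has some
Frobenius twist with a proper birational model SMOOTH over `M(t)`». [folklore] -/
theorem climbRatFuncPerfDimLe_five_four_of_forall_frobeniusTwistStepRegularAt_four {p : ℕ} [Fact p.Prime]
    (h : ∀ (M : Type) [Field M] [CharP M p] [PerfectField M], FrobeniusTwistStepRegularAt p M 4) :
    ClimbRatFuncPerfDimLe p 5 4 :=
  climbRatFuncPerfDimLe_five_four_of_perfectionStep_four
    ((perfectionStepDimLe_iff_forall_frobeniusTwistStepRegularAt p 4).2 h)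

end Summit.ResolutionOfSingularities.ResolutionOfSingularities.Theorems.CampaignW82

end
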